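import Literature.Analysis.FluidPDE.CompressibleEulerImplosionUniqueness
import Literature.Analysis.FluidPDE.CompressibleEulerImplosionAuxSigns
import Literature.Analysis.FluidPDE.CompressibleEulerImplosionTrapping
import HarnessLib

/-!
# Buckmaster–Cao-Labora–Gómez-Serrano at `γ = 5/3`: the triangle `𝒯^{(H)}` is a trapping region

Topic `Literature/Analysis/FluidPDE`; namespace
`Literature.Analysis.FluidPDE.BuckmasterCaolaboraGomezserrano2025.Monatomic`. Companion of
`CompressibleEulerImplosion.lean` (named fact `BuckmasterCaolaboraGomezserrano2025_thm11_monatomic`,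
THEOREM 1.1 of T. Buckmaster, G. Cao-Labora, J. Gómez-Serrano, *Smooth imploding solutions for 3D
compressible fluids*, Forum Math. Pi 13 (2025) e6, arXiv:2208.09445, at `γ = 5/3`, `α = 1/3`);
uses `CompressibleEulerImplosionUniqueness.lean` (the field `F = (N_W/D_W, N_Z/D_Z)`),
`CompressibleEulerImplosionAuxSigns.lean` (Lemmas 9.16, 9.21, 9.22 at `γ = 5/3`) and
`CompressibleEulerImplosionTrapping.lean` (multi-barrier trapping lemma).

Brick D2-trap of the discharge plan — the invariance half of the second part of Proposition 2.5
("We now show that the solution cannot come from the boundary of `𝒯^{(H)}` except from point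
`P_s`"): for `1 < r < r*` and any `H`, the closed triangle `𝒯^{(H)}` with vertices `P_s`,
`P^{(H)} = P_s + (H, −H)`, `P̌^{(H)} ∈ {D_Z = 0}` — i.e. `{W ≤ W₀ + H} ∩ {(W−W₀)+(Z−Z₀) ≥ 0} ∩
{D_Z ≤ 0}` — is forward invariant for solutions of (1.8) that stay off the sonic line `D_Z = 0`
(`triangle_invariant`, sets `tri r H`, `offSonic`); along such solutions `D_W > 0`, `N_W < 0` and
`W` is strictly decreasing (Remark 2.6). The remaining half of Prop. 2.5 part 2 (the trajectory issued from `P₀` enters the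
triangle and can only leave `{D_Z ≠ 0}` at `P_s`) is not in this file. Two real definitions with
bodies (the sets `tri`, `offSonic`), theorems otherwise.
[cite: BuckmasterCaolaboraGomezserrano2025, Prop. 2.5 (proof), Remark 2.6, Lemmas 9.16, 9.21, 9.22]
-/

noncomputable section

open Set Filter Topology

namespace Literature.Analysis.FluidPDE

namespace BuckmasterCaolaboraGomezserrano2025

namespace Monatomic

open ODE

variable {r : ℝ}

/-! ### The triangle in the coordinates `u = W − W₀`, `v = Z − Z₀` -/

/-- `D_Z` is affine and vanishes at `P_s`: `D_Z(W, Z) = ((W − W₀) + 2(Z − Z₀))/3`. [folklore] -/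
theorem DZ_eq_uv (r W Z : ℝ) : DZ W Z = ((W - W0 r) + 2 * (Z - Z0 r)) / 3 := by
  unfold DZ W0 Z0; ring

/-- `D_W(W, Z) = D_W(P_s) + (2(W − W₀) + (Z − Z₀))/3`. [folklore] -/
theorem DW_eq_uv (r W Z : ℝ) : DW W Z = DW (W0 r) (Z0 r) + (2 * (W - W0 r) + (Z - Z0 r)) / 3 := by
  unfold DW; ring

/-- Inside the triangle (`(W−W₀)+(Z−Z₀) ≥ 0`, `D_Z ≤ 0`): `u = W − W₀ ≥ 0`, `v = Z − Z₀ ≤ 0`,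
`−u ≤ v ≤ −u/2`. [cite: BuckmasterCaolaboraGomezserrano2025, Lemma 9.16 (proof)] -/
theorem triangle_uv {W Z : ℝ} (h2 : 0 ≤ (W - W0 r) + (Z - Z0 r)) (h3 : DZ W Z ≤ 0) :
    0 ≤ W - W0 r ∧ Z - Z0 r ≤ 0 ∧ -(W - W0 r) ≤ Z - Z0 r ∧ 2 * (Z - Z0 r) ≤ -(W - W0 r) := by
  rw [DZ_eq_uv r] at h3
  refine ⟨by linarith, by linarith, by linarith, by linarith⟩

/-- Second-order expansion of `N_W` at `P_s` in `(u, v)`. [cite: BuckmasterCaolaboraGomezserrano2025, Lemma 9.16 (proof)] -/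
theorem NW_expand_uv (r W Z : ℝ) :
    NW r W Z = NW r (W0 r) (Z0 r)
      + ((r - 2) * (2 * (W - W0 r) + (Z - Z0 r)) - q r * (3 * (W - W0 r) + (Z - Z0 r)))
      + ((Z - Z0 r) ^ 2 - 2 * (W - W0 r) * (Z - Z0 r) - 5 * (W - W0 r) ^ 2) / 6 := by
  unfold NW W0 Z0; ring

/-- On the closed triangle, `N_W ≤ N_W(P_s)` (both correction terms of the expansion are `≤ 0`),
for `r < r*`. [cite: BuckmasterCaolaboraGomezserrano2025, Lemma 9.16 (proof)] -/
theorem NW_le_of_triangle (hr : r < rstar) {W Z : ℝ} (h2 : 0 ≤ (W - W0 r) + (Z - Z0 r))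
    (h3 : DZ W Z ≤ 0) : NW r W Z ≤ NW r (W0 r) (Z0 r) := by
  obtain ⟨hu, hv, hv1, hv2⟩ := triangle_uv h2 h3
  rw [NW_expand_uv r W Z]
  have hq := q_pos hr
  have hr2 : r < 2 := by linarith [rstar_lt]
  set u := W - W0 r
  set v := Z - Z0 r
  have hA : (r - 2) * (2 * u + v) - q r * (3 * u + v) ≤ 0 := by nlinarith
  have hB : (v ^ 2 - 2 * u * v - 5 * u ^ 2) / 6 ≤ 0 := by nlinarith
  linarith

/-- **Lemma 9.16 on the closed triangle**: `N_W < 0` at every point of `𝒯^{(H)}` (any `H`), for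
`r < r*`. [cite: BuckmasterCaolaboraGomezserrano2025, Lemma 9.16] -/
theorem NW_neg_of_triangle (hr : r < rstar) {W Z : ℝ} (h2 : 0 ≤ (W - W0 r) + (Z - Z0 r))
    (h3 : DZ W Z ≤ 0) : NW r W Z < 0 :=
  (NW_le_of_triangle hr h2 h3).trans_lt (NW_Ps_neg hr)

/-- `D_W > 0` on the closed triangle, for `r < 2`. [cite: BuckmasterCaolaboraGomezserrano2025, Prop. 2.5 (proof)] -/
theorem DW_pos_of_triangle (hr2 : r < 2) {W Z : ℝ} (h2 : 0 ≤ (W - W0 r) + (Z - Z0 r))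
    (h3 : DZ W Z ≤ 0) : 0 < DW W Z := by
  obtain ⟨hu, hv, hv1, hv2⟩ := triangle_uv h2 h3
  rw [DW_eq_uv r]
  have := DW_Ps_pos hr2
  nlinarith

/-- `D_W ≤ D_W(P_s) + 2H/3` on the closed triangle `𝒯^{(H)}`. [folklore] -/
theorem DW_le_of_triangle {W Z H : ℝ} (h1 : W ≤ W0 r + H) (h2 : 0 ≤ (W - W0 r) + (Z - Z0 r))
    (h3 : DZ W Z ≤ 0) : DW W Z ≤ DW (W0 r) (Z0 r) + 2 * H / 3 := by
  obtain ⟨hu, hv, _, _⟩ := triangle_uv h2 h3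
  rw [DW_eq_uv r W Z]
  linarith

/-- `W > Z` on the closed triangle, for `r < 2`. [cite: BuckmasterCaolaboraGomezserrano2025, Prop. 2.5 (proof)] -/
theorem W_gt_Z_of_triangle (hr2 : r < 2) {W Z : ℝ} (h2 : 0 ≤ (W - W0 r) + (Z - Z0 r))
    (h3 : DZ W Z ≤ 0) : Z < W := by
  obtain ⟨hu, hv, _, _⟩ := triangle_uv h2 h3
  have := W0_sub_Z0_pos hr2
  linarith

/-! ### The triangle and the off-sonic region as sets -/

/-- The closed triangle `𝒯^{(H)}` with vertices `P_s`, `P_s + (H, −H)` and the point of the sonic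
line `D_Z = 0` above the latter: `{W ≤ W₀ + H} ∩ {(W − W₀) + (Z − Z₀) ≥ 0} ∩ {D_Z ≤ 0}`.
[cite: BuckmasterCaolaboraGomezserrano2025, Prop. 2.5 (proof), Lemma 9.16] -/
def tri (r H : ℝ) : Set (ℝ × ℝ) :=
  {p | p.1 ≤ W0 r + H ∧ 0 ≤ (p.1 - W0 r) + (p.2 - Z0 r) ∧ DZ p.1 p.2 ≤ 0}

/-- [folklore] -/
theorem mem_tri {r H : ℝ} {p : ℝ × ℝ} :
    p ∈ tri r H ↔ p.1 ≤ W0 r + H ∧ 0 ≤ (p.1 - W0 r) + (p.2 - Z0 r) ∧ DZ p.1 p.2 ≤ 0 := Iff.rfl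

/-- [folklore] -/
theorem continuous_DZ : Continuous fun p : ℝ × ℝ => DZ p.1 p.2 := by
  unfold DZ; fun_prop

/-- [folklore] -/
theorem continuous_DW : Continuous fun p : ℝ × ℝ => DW p.1 p.2 := by
  unfold DW; fun_prop

/-- [folklore] -/
theorem continuous_NZ (r : ℝ) : Continuous fun p : ℝ × ℝ => NZ r p.1 p.2 := by
  unfold NZ; fun_prop

/-- [folklore] -/
theorem continuous_NW (r : ℝ) : Continuous fun p : ℝ × ℝ => NW r p.1 p.2 := by
  unfold NW; fun_prop

/-- The triangle is closed. [folklore] -/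
theorem isClosed_tri (r H : ℝ) : IsClosed (tri r H) := by
  have e : tri r H = {p : ℝ × ℝ | p.1 ≤ W0 r + H} ∩ {p | 0 ≤ (p.1 - W0 r) + (p.2 - Z0 r)}
      ∩ {p | DZ p.1 p.2 ≤ 0} := by
    ext p; simp only [mem_tri, mem_inter_iff, mem_setOf_eq, and_assoc]
  rw [e]
  refine ((isClosed_le continuous_fst continuous_const).inter
    (isClosed_le continuous_const (by fun_prop))).inter (isClosed_le continuous_DZ continuous_const)

/-- Points of the triangle have `W − W₀ ∈ [0, H]` and `Z − Z₀ ∈ [−H, 0]`. [folklore] -/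
theorem tri_subset_Icc {r H : ℝ} {p : ℝ × ℝ} (hp : p ∈ tri r H) :
    p.1 ∈ Icc (W0 r) (W0 r + H) ∧ p.2 ∈ Icc (Z0 r - H) (Z0 r) := by
  obtain ⟨h1, h2, h3⟩ := hp
  obtain ⟨hu, hv, hv1, _⟩ := triangle_uv h2 h3
  exact ⟨⟨by linarith, h1⟩, ⟨by linarith, by linarith⟩⟩

/-- The triangle is compact. [folklore] -/
theorem isCompact_tri (r H : ℝ) : IsCompact (tri r H) := by
  refine (isCompact_Icc.prod isCompact_Icc : IsCompact
    (Icc (W0 r) (W0 r + H) ×ˢ Icc (Z0 r - H) (Z0 r))).of_isClosed_subset (isClosed_tri r H) ?_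
  intro p hp
  exact mem_prod.mpr (tri_subset_Icc hp)

/-- The open region off both sonic lines, `{D_W ≠ 0} ∩ {D_Z ≠ 0}`, on which the field
`(N_W/D_W, N_Z/D_Z)` of (1.8) is `C¹`. [cite: BuckmasterCaolaboraGomezserrano2025, §1.3] -/
def offSonic : Set (ℝ × ℝ) := {p | DW p.1 p.2 ≠ 0 ∧ DZ p.1 p.2 ≠ 0}

/-- [folklore] -/
theorem mem_offSonic {p : ℝ × ℝ} : p ∈ offSonic ↔ DW p.1 p.2 ≠ 0 ∧ DZ p.1 p.2 ≠ 0 := Iff.rfl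

/-- [folklore] -/
theorem isOpen_offSonic : IsOpen offSonic :=
  (isOpen_compl_singleton.preimage continuous_DW).inter
    (isOpen_compl_singleton.preimage continuous_DZ)

/-- The field of (1.8) is `C¹` on `offSonic`. [folklore] -/
theorem contDiffAt_field_of_mem {r : ℝ} {p : ℝ × ℝ} (hp : p ∈ offSonic) :
    ContDiffAt ℝ 1 (field r) p :=
  contDiffAt_field hp.1 hp.2

/-- Inside the triangle and off `D_Z = 0` one is off both sonic lines (`D_W > 0` there), for
`r < 2`. [folklore] -/
theorem mem_offSonic_of_tri {r H : ℝ} (hr2 : r < 2) {p : ℝ × ℝ} (hp : p ∈ tri r H)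
    (hDZ : DZ p.1 p.2 ≠ 0) : p ∈ offSonic :=
  ⟨(DW_pos_of_triangle hr2 hp.2.1 hp.2.2).ne', hDZ⟩

/-! ### A three-constraint form of the trapping lemma -/

/-- The trapping lemma for three constraints. [folklore] -/
theorem forall_le_zero_of_deriv_neg₃ {g₀ g₁ g₂ g₀' g₁' g₂' : ℝ → ℝ} {a b : ℝ}
    (h₀ : ∀ ξ ∈ Ico a b, HasDerivAt g₀ (g₀' ξ) ξ) (h₁ : ∀ ξ ∈ Ico a b, HasDerivAt g₁ (g₁' ξ) ξ)
    (h₂ : ∀ ξ ∈ Ico a b, HasDerivAt g₂ (g₂' ξ) ξ)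
    (ha : g₀ a ≤ 0 ∧ g₁ a ≤ 0 ∧ g₂ a ≤ 0)
    (hkey : ∀ ξ ∈ Ico a b, g₀ ξ ≤ 0 → g₁ ξ ≤ 0 → g₂ ξ ≤ 0 →
      (g₀ ξ = 0 → g₀' ξ < 0) ∧ (g₁ ξ = 0 → g₁' ξ < 0) ∧ (g₂ ξ = 0 → g₂' ξ < 0)) :
    ∀ ξ ∈ Ico a b, g₀ ξ ≤ 0 ∧ g₁ ξ ≤ 0 ∧ g₂ ξ ≤ 0 := by
  set g : Fin 3 → ℝ → ℝ := ![g₀, g₁, g₂] with hg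
  set g' : Fin 3 → ℝ → ℝ := ![g₀', g₁', g₂'] with hg'
  have e0 : g 0 = g₀ := rfl
  have e1 : g 1 = g₁ := rfl
  have e2 : g 2 = g₂ := rfl
  have e0' : g' 0 = g₀' := rfl
  have e1' : g' 1 = g₁' := rfl
  have e2' : g' 2 = g₂' := rfl
  have H := forall_le_zero_of_deriv_neg (g := g) (g' := g') (a := a) (b := b) ?_ ?_ ?_
  · intro ξ hξ
    exact ⟨e0 ▸ H ξ hξ 0, e1 ▸ H ξ hξ 1, e2 ▸ H ξ hξ 2⟩
  · intro i ξ hξ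
    fin_cases i
    · exact h₀ ξ hξ
    · exact h₁ ξ hξ
    · exact h₂ ξ hξ
  · intro i
    fin_cases i
    · exact ha.1
    · exact ha.2.1
    · exact ha.2.2
  · intro ξ hξ hall i hi
    have hk := hkey ξ hξ (hall 0) (hall 1) (hall 2)
    fin_cases i
    · exact hk.1 hi
    · exact hk.2.1 hi
    · exact hk.2.2 hi

/-! ### The triangle is forward invariant -/

/-- **Proposition 2.5, the trapping step, at `γ = 5/3`.** Let `1 < r < r*` and `H ∈ ℝ`. A solution
`c = (W, Z)` of (1.8) on `[a, b)` which stays off the sonic line `{D_Z = 0}` and starts in the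
closed triangle `𝒯^{(H)} = {W ≤ W₀ + H} ∩ {(W − W₀) + (Z − Z₀) ≥ 0} ∩ {D_Z ≤ 0}` stays in it:
it cannot leave through the vertical side (`W′ = N_W/D_W < 0`, Lemma 9.16), nor through the side
of slope `−1` (Lemma 9.21), and it never touches `{D_Z = 0}`.
[cite: BuckmasterCaolaboraGomezserrano2025, Prop. 2.5 (proof), Lemmas 9.16, 9.21] -/
theorem triangle_invariant (h1 : 1 < r) (hr : r < rstar) (H : ℝ) {c : ℝ → ℝ × ℝ} {a b : ℝ}
    (hc : ∀ ξ ∈ Ico a b, HasDerivAt c (field r (c ξ)) ξ)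
    (hDZ : ∀ ξ ∈ Ico a b, DZ (c ξ).1 (c ξ).2 ≠ 0)
    (h0 : (c a).1 ≤ W0 r + H ∧ 0 ≤ ((c a).1 - W0 r) + ((c a).2 - Z0 r) ∧ DZ (c a).1 (c a).2 ≤ 0) :
    ∀ ξ ∈ Ico a b,
      (c ξ).1 ≤ W0 r + H ∧ 0 ≤ ((c ξ).1 - W0 r) + ((c ξ).2 - Z0 r) ∧ DZ (c ξ).1 (c ξ).2 < 0 := by
  have hr2 : r < 2 := by linarith [rstar_lt]
  -- the three constraints along the curve
  set g₀ : ℝ → ℝ := fun ξ => (c ξ).1 - (W0 r + H) with hg₀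
  set g₁ : ℝ → ℝ := fun ξ => (W0 r - (c ξ).1) + (Z0 r - (c ξ).2) with hg₁
  set g₂ : ℝ → ℝ := fun ξ => DZ (c ξ).1 (c ξ).2 with hg₂
  set g₀' : ℝ → ℝ := fun ξ => (field r (c ξ)).1 with hg₀'
  set g₁' : ℝ → ℝ := fun ξ => -(field r (c ξ)).1 - (field r (c ξ)).2 with hg₁'
  set g₂' : ℝ → ℝ := fun ξ => ((field r (c ξ)).1 + 2 * (field r (c ξ)).2) / 3 with hg₂'
  have hc1 : ∀ ξ ∈ Ico a b, HasDerivAt (fun s => (c s).1) (field r (c ξ)).1 ξ :=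
    fun ξ hξ => (hc ξ hξ).fst
  have hc2 : ∀ ξ ∈ Ico a b, HasDerivAt (fun s => (c s).2) (field r (c ξ)).2 ξ :=
    fun ξ hξ => (hc ξ hξ).snd
  have hd₀ : ∀ ξ ∈ Ico a b, HasDerivAt g₀ (g₀' ξ) ξ := fun ξ hξ => (hc1 ξ hξ).sub_const _
  have hd₁ : ∀ ξ ∈ Ico a b, HasDerivAt g₁ (g₁' ξ) ξ := fun ξ hξ => by
    have h := ((hc1 ξ hξ).const_sub (W0 r)).add ((hc2 ξ hξ).const_sub (Z0 r))
    refine h.congr_deriv ?_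
    simp only [hg₁']; ring
  have hd₂ : ∀ ξ ∈ Ico a b, HasDerivAt g₂ (g₂' ξ) ξ := fun ξ hξ => by
    have h := (((hc1 ξ hξ).add ((hc2 ξ hξ).const_mul 2)).div_const 3).const_add 1
    have e : g₂ = fun ξ => 1 + ((c ξ).1 + 2 * (c ξ).2) / 3 := by
      funext ξ; simp only [hg₂]; unfold DZ; ring
    rw [e]
    exact h
  have key := forall_le_zero_of_deriv_neg₃ hd₀ hd₁ hd₂
    ⟨by simp only [hg₀]; linarith [h0.1], by simp only [hg₁]; linarith [h0.2.1],
      by simp only [hg₂]; exact h0.2.2⟩ ?_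
  · intro ξ hξ
    obtain ⟨k0, k1, k2⟩ := key ξ hξ
    simp only [hg₀, hg₁, hg₂] at k0 k1 k2
    exact ⟨by linarith, by linarith, lt_of_le_of_ne k2 (hDZ ξ hξ)⟩
  · intro ξ hξ k0 k1 k2
    simp only [hg₀, hg₁, hg₂] at k0 k1 k2
    have h2 : 0 ≤ ((c ξ).1 - W0 r) + ((c ξ).2 - Z0 r) := by linarith
    have hDZneg : DZ (c ξ).1 (c ξ).2 < 0 := lt_of_le_of_ne k2 (hDZ ξ hξ)
    have hDW : 0 < DW (c ξ).1 (c ξ).2 := DW_pos_of_triangle hr2 h2 k2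
    have hNW : NW r (c ξ).1 (c ξ).2 < 0 := NW_neg_of_triangle hr h2 k2
    have hW' : (field r (c ξ)).1 < 0 := by
      show NW r (c ξ).1 (c ξ).2 / DW (c ξ).1 (c ξ).2 < 0
      exact div_neg_of_neg_of_pos hNW hDW
    refine ⟨fun _ => hW', fun hk1 => ?_, fun hk2 => absurd hk2 (hDZ ξ hξ)⟩
    -- on the side of slope `-1`: `c ξ = (W₀ + t, Z₀ - t)` with `t > 0`
    set t := (c ξ).1 - W0 r with ht
    have hct : (c ξ).1 = W0 r + t ∧ (c ξ).2 = Z0 r - t := ⟨by ring, by linarith⟩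
    have htpos : 0 < t := by
      rcases lt_or_eq_of_le (triangle_uv h2 k2).1 with h | h
      · exact h
      · exfalso
        have hW : (c ξ).1 = W0 r := by linarith
        have hZ : (c ξ).2 = Z0 r := by linarith
        exact hDZ ξ hξ (by rw [hW, hZ]; exact DZ_Ps r)
    have hS := S1_crossing h1 hr htpos
    rw [← hct.1, ← hct.2] at hS
    -- `g₁' = -(N_W D_Z + N_Z D_W)/(D_W D_Z)` with `D_W D_Z < 0`
    show -(field r (c ξ)).1 - (field r (c ξ)).2 < 0
    unfold field
    dsimp only
    have hprod : DW (c ξ).1 (c ξ).2 * DZ (c ξ).1 (c ξ).2 < 0 := mul_neg_of_pos_of_neg hDW hDZneg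
    have hsum : NW r (c ξ).1 (c ξ).2 / DW (c ξ).1 (c ξ).2 + NZ r (c ξ).1 (c ξ).2 / DZ (c ξ).1 (c ξ).2
        = (NW r (c ξ).1 (c ξ).2 * DZ (c ξ).1 (c ξ).2 + DW (c ξ).1 (c ξ).2 * NZ r (c ξ).1 (c ξ).2)
          / (DW (c ξ).1 (c ξ).2 * DZ (c ξ).1 (c ξ).2) := div_add_div _ _ hDW.ne' hDZneg.ne
    have hS' : NW r (c ξ).1 (c ξ).2 * DZ (c ξ).1 (c ξ).2 + DW (c ξ).1 (c ξ).2 * NZ r (c ξ).1 (c ξ).2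
        < 0 := by linarith [mul_comm (DW (c ξ).1 (c ξ).2) (NZ r (c ξ).1 (c ξ).2)]
    have hpos : 0 < NW r (c ξ).1 (c ξ).2 / DW (c ξ).1 (c ξ).2
        + NZ r (c ξ).1 (c ξ).2 / DZ (c ξ).1 (c ξ).2 := by
      rw [hsum]; exact div_pos_of_neg_of_neg hS' hprod
    linarith

/-- Along such a solution: `D_Z < 0 < D_W`, `N_W < 0`, hence `W′ < 0` — `W` is strictly
decreasing (Remark 2.6: "`W_r^o(ξ)` is decreasing"). [cite: BuckmasterCaolaboraGomezserrano2025, Remark 2.6] -/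
theorem triangle_W_strictAnti (h1 : 1 < r) (hr : r < rstar) (H : ℝ) {c : ℝ → ℝ × ℝ} {a b : ℝ}
    (hc : ∀ ξ ∈ Ico a b, HasDerivAt c (field r (c ξ)) ξ)
    (hDZ : ∀ ξ ∈ Ico a b, DZ (c ξ).1 (c ξ).2 ≠ 0)
    (h0 : (c a).1 ≤ W0 r + H ∧ 0 ≤ ((c a).1 - W0 r) + ((c a).2 - Z0 r) ∧ DZ (c a).1 (c a).2 ≤ 0) :
    (∀ ξ ∈ Ico a b, DZ (c ξ).1 (c ξ).2 < 0 ∧ 0 < DW (c ξ).1 (c ξ).2 ∧ NW r (c ξ).1 (c ξ).2 < 0) ∧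
    StrictAntiOn (fun ξ => (c ξ).1) (Ico a b) := by
  have hr2 : r < 2 := by linarith [rstar_lt]
  have hin := triangle_invariant h1 hr H hc hDZ h0
  have hsign : ∀ ξ ∈ Ico a b, DZ (c ξ).1 (c ξ).2 < 0 ∧ 0 < DW (c ξ).1 (c ξ).2
      ∧ NW r (c ξ).1 (c ξ).2 < 0 := fun ξ hξ =>
    ⟨(hin ξ hξ).2.2, DW_pos_of_triangle hr2 (hin ξ hξ).2.1 (hin ξ hξ).2.2.le,
      NW_neg_of_triangle hr (hin ξ hξ).2.1 (hin ξ hξ).2.2.le⟩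
  refine ⟨hsign, ?_⟩
  have hc1 : ∀ ξ ∈ Ico a b, HasDerivAt (fun s => (c s).1) (field r (c ξ)).1 ξ :=
    fun ξ hξ => (hc ξ hξ).fst
  refine strictAntiOn_of_deriv_neg (convex_Ico a b)
    (fun ξ hξ => (hc1 ξ hξ).continuousAt.continuousWithinAt) fun ξ hξ => ?_
  have hξ' : ξ ∈ Ico a b := interior_subset hξ
  rw [(hc1 ξ hξ').deriv]
  show NW r (c ξ).1 (c ξ).2 / DW (c ξ).1 (c ξ).2 < 0
  exact div_neg_of_neg_of_pos (hsign ξ hξ').2.2 (hsign ξ hξ').2.1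

end Monatomic

end BuckmasterCaolaboraGomezserrano2025

end Literature.Analysis.FluidPDE
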